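import Summits.KontsevichZagierPeriods.KontsevichZagierPeriods.Theses.VeryGoodTransfer
import Literature.NumberTheory.Transcendental.KZSemiCanonicalReductionProofs
import Literature.NumberTheory.Transcendental.KZLogCalculusProofs
import Literature.NumberTheory.Transcendental.SemialgebraicMapsProofs

/-!
# Route VeryGoodTransfer — typed split of the crux `RationalRepsResolve` (BC2 redirect)

`Summit.KontsevichZagierPeriods.KontsevichZagierPeriods.Theses.VeryGoodTransfer.RationalRepsResolve`
(item stmt-KontsevichZagierPeriods-5089: every integral representation of KZ's rational shape is
move-equivalent to a `ℤ`-combination of representations of the same dimension with bounded domain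
and integrand `C¹` on a neighbourhood of the closure of the domain) is derived here from three typed
pieces of three different kinds, none of which mentions periods, values or — for the first two — the
moves:

* **X₁ `MonomialCubeAtlas`** (real algebraic geometry; Hironaka-type embedded resolution read as an
  atlas): for a bounded `ℚ`-semialgebraic `σ ⊆ ℝⁿ` and `p ≠ 0`, `q` non-vanishing on `σ`, finitely
  many injective `ℚ`-semialgebraic differentiable charts `φᵢ` of the open unit cube `C`, with
  `φᵢ(C) ⊆ σ`, sub-pieces `τᵢ ⊆ C` whose images a.e.-partition `σ`, and on all of `C` the pulled-back
  density `(p/q ∘ φᵢ)·|det φᵢ'| = uᵢ · ∏ⱼ xⱼ^{aᵢⱼ}` with INTEGER exponents `aᵢⱼ` and a unit `uᵢ`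
  (`C¹` and non-vanishing on a neighbourhood of the closed cube, `ℚ`-semialgebraic on `C`);
* **X₂ `CubeMonomialIntegrability`** (analysis; the monomial argument of Huber–Müller-Stach,
  Lemma 11.2.2 of the 2015 draft of *Periods and Nori motives*, Part III): an integrable
  `unit × monomial` on the open unit cube has non-negative exponents;
* **X₃ `ResolvedAtlasRealisation`** (the calculus of moves): an atlas of injective
  `ℚ`-semialgebraic differentiable charts with `C¹`-up-to-the-boundary pulled-back integrands whose
  images a.e.-partition the domain is realised by rules (1a) + (2): `[r] ≡ ∑ᵢ [τᵢ, gᵢ]`.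

The assembly `rationalRepsResolve_of_subs : X₁ → X₂ → X₃ → RationalRepsResolve` is NOT a
conjunction seam: it compactifies inside the rules by the tree's
`Literature.NumberTheory.Transcendental.KZ.exists_sub_sum_bounded_mem_relations` (Viu-Sos 2021,
Thm. 2.1 at the level of moves), disposes of `p = 0`, transports absolute integrability through each
chart by the Jacobian formula (`MeasureTheory.integrableOn_image_iff_integrableOn_abs_det_fderiv_smul`),
upgrades the exponents by X₂ so that the densities `uᵢ · ∏ xⱼ^{aᵢⱼ}` become `C¹` up to the boundary
and `ℚ`-semialgebraic, realises the atlas by X₃, and re-indexes the iterated resolution over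
`Σ T, Fin (k T)`. The three hypotheses are stated verbatim as the route's split children (this file
makes no definition).

References: J. Viu-Sos, *A semi-canonical reduction for periods of Kontsevich–Zagier*, IJNT 17 (2021),
Thm. 2.1, Cor. 2.2 (arXiv:1509.01097); A. Huber, S. Müller-Stach, *Periods and Nori motives*
(Springer 2017), Lemma 11.2.2 of the 2015 draft; H. Hironaka, Ann. Math. 79 (1964);
J. Bochnak, M. Coste, M.-F. Roy, *Real Algebraic Geometry* (1998), §§2.2, 2.9, 9.1.
-/

noncomputable section

open MeasureTheory Set
open Literature.NumberTheory.Transcendental Literature.ModelTheory.ExponentialFields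
open Literature.NumberTheory.Transcendental.KZ

namespace Summit.KontsevichZagierPeriods.VeryGoodTransfer.RationalRepsResolveSplit

variable {n : ℕ}
/-! ### The open unit cube -/

/-- The open unit cube is open. [folklore] -/
theorem isOpen_cube : IsOpen {x : Fin n → ℝ | ∀ j, 0 < x j ∧ x j < 1} := by
  have : {x : Fin n → ℝ | ∀ j, 0 < x j ∧ x j < 1} = ⋂ j, ({x | 0 < x j} ∩ {x | x j < 1}) := by
    ext x; simp [Set.mem_iInter]
  rw [this]
  exact isOpen_iInter_of_finite fun j =>
    (isOpen_lt continuous_const (continuous_apply j)).inter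
      (isOpen_lt (continuous_apply j) continuous_const)

/-- The open unit cube is bounded. [folklore] -/
theorem isBounded_cube : Bornology.IsBounded {x : Fin n → ℝ | ∀ j, 0 < x j ∧ x j < 1} := by
  refine (isCompact_Icc (a := (0 : Fin n → ℝ)) (b := 1)).isBounded.subset fun x hx => ?_
  exact ⟨fun j => (hx j).1.le, fun j => (hx j).2.le⟩

/-! ### Re-indexing of iterated resolutions -/

/-- **Chaining resolutions.** If `c ≡ ∑ₜ [Rₜ]` modulo relations and every `[Rₜ]` is congruent to a
`ℤ`-combination of representations satisfying `P`, then so is `c` (re-index the total family over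
`Σ t, Fin (k t)` by `Fintype.equivFin`). [folklore] -/
theorem exists_fin_of_sub_sum {ι : Type*} [Fintype ι] (P : IntegralRep n → Prop) (c : FormalRep)
    (R : ι → IntegralRep n) (hrel : c - ∑ t, of (R t) ∈ relations)
    (hres : ∀ t, ∃ (k : ℕ) (ρ : Fin k → IntegralRep n) (ε : Fin k → ℤ),
      (∀ i, P (ρ i)) ∧ of (R t) - ∑ i, ε i • of (ρ i) ∈ relations) :
    ∃ (k : ℕ) (ρ : Fin k → IntegralRep n) (ε : Fin k → ℤ),
      (∀ i, P (ρ i)) ∧ c - ∑ i, ε i • of (ρ i) ∈ relations := by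
  classical
  choose k ρ ε hP hrelt using hres
  set S := Σ t : ι, Fin (k t)
  set e : S ≃ Fin (Fintype.card S) := Fintype.equivFin S
  refine ⟨Fintype.card S, fun j => ρ (e.symm j).1 (e.symm j).2, fun j => ε (e.symm j).1 (e.symm j).2,
    fun j => hP _ _, ?_⟩
  have hsum : ∑ j : Fin (Fintype.card S), ε (e.symm j).1 (e.symm j).2 • of (ρ (e.symm j).1 (e.symm j).2) =
      ∑ t, ∑ i, ε t i • of (ρ t i) := by
    rw [Fintype.sum_equiv e.symm (fun j => ε (e.symm j).1 (e.symm j).2 • of (ρ (e.symm j).1 (e.symm j).2))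
      (fun s : S => ε s.1 s.2 • of (ρ s.1 s.2)) (fun j => rfl)]
    rw [← Finset.univ_sigma_univ, Finset.sum_sigma]
  rw [hsum]
  have : c - ∑ t, ∑ i, ε t i • of (ρ t i) =
      (c - ∑ t, of (R t)) + ∑ t, (of (R t) - ∑ i, ε t i • of (ρ t i)) := by
    rw [Finset.sum_sub_distrib]; abel
  rw [this]
  exact relations.add_mem hrel (sum_mem fun t _ => hrelt t)


/-! ### The typed split -/

/-- **Typed split of the crux `RationalRepsResolve`** (route VeryGoodTransfer, item
stmt-KontsevichZagierPeriods-5089; BC2 redirect): `MonomialCubeAtlas → CubeMonomialIntegrability →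
ResolvedAtlasRealisation → RationalRepsResolve`, the three hypotheses being stated verbatim (they are
the route's split children). Proof: compactify inside the rules
(`KZ.exists_sub_sum_bounded_mem_relations`); a bounded piece of rational shape `p/q` with `p = 0` is
a relation (`KZ.of_mem_relations_of_eqOn_zero`); otherwise take the monomialising cube atlas (X₁),
transport absolute integrability of `p/q` on `φᵢ(C) ⊆ σ` to `uᵢ · ∏ xⱼ^{aᵢⱼ}` on the cube by the
Jacobian formula, get `aᵢⱼ ≥ 0` from X₂, so that `gᵢ := uᵢ · ∏ xⱼ^{aᵢⱼ}` is `C¹` on the given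
neighbourhood of the closed cube and `ℚ`-semialgebraic, realise the atlas `(τᵢ, φᵢ, gᵢ)` by X₃, and
re-index (`exists_fin_of_sub_sum`). [cite: ViuSos2021, Thm. 2.1 and Cor. 2.2] -/
theorem rationalRepsResolve_of_subs
    (hA : ∀ (n : ℕ) (σ : Set (Fin n → ℝ)) (p q : MvPolynomial (Fin n) ℚ),
        Literature.ModelTheory.ExponentialFields.IsSemialgebraic ℚ σ → Bornology.IsBounded σ → p ≠ 0 →
        (∀ x ∈ σ, MvPolynomial.aeval x q ≠ 0) →
        ∃ (k : ℕ) (τ : Fin k → Set (Fin n → ℝ)) (φ : Fin k → (Fin n → ℝ) → (Fin n → ℝ))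
          (φ' : Fin k → (Fin n → ℝ) → (Fin n → ℝ) →L[ℝ] (Fin n → ℝ)) (u : Fin k → (Fin n → ℝ) → ℝ)
          (U : Fin k → Set (Fin n → ℝ)) (a : Fin k → Fin n → ℤ),
          (∀ i, τ i ⊆ {x : Fin n → ℝ | ∀ j, 0 < x j ∧ x j < 1} ∧
            Literature.ModelTheory.ExponentialFields.IsSemialgebraic ℚ (τ i) ∧
            Literature.NumberTheory.Transcendental.IsSemialgebraicMapOn ℚ {x : Fin n → ℝ | ∀ j, 0 < x j ∧ x j < 1} (φ i) ∧
            (∀ x ∈ {x : Fin n → ℝ | ∀ j, 0 < x j ∧ x j < 1},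
              HasFDerivWithinAt (φ i) (φ' i x) {x : Fin n → ℝ | ∀ j, 0 < x j ∧ x j < 1} x) ∧
            Set.InjOn (φ i) {x : Fin n → ℝ | ∀ j, 0 < x j ∧ x j < 1} ∧
            φ i '' {x : Fin n → ℝ | ∀ j, 0 < x j ∧ x j < 1} ⊆ σ ∧
            Literature.ModelTheory.ExponentialFields.IsSemialgebraic ℚ (φ i '' τ i) ∧
            IsOpen (U i) ∧ closure {x : Fin n → ℝ | ∀ j, 0 < x j ∧ x j < 1} ⊆ U i ∧
            ContDiffOn ℝ 1 (u i) (U i) ∧ (∀ x ∈ U i, u i x ≠ 0) ∧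
            Literature.NumberTheory.Transcendental.IsSemialgebraicFunOn ℚ {x : Fin n → ℝ | ∀ j, 0 < x j ∧ x j < 1} (u i) ∧
            ∀ x ∈ {x : Fin n → ℝ | ∀ j, 0 < x j ∧ x j < 1},
              MvPolynomial.aeval (φ i x) p / MvPolynomial.aeval (φ i x) q * |(φ' i x).det| =
                u i x * ∏ j, x j ^ (a i j)) ∧
          (∀ i j, i ≠ j → MeasureTheory.volume (φ i '' τ i ∩ φ j '' τ j) = 0) ∧
          MeasureTheory.volume (σ \ ⋃ i, φ i '' τ i) = 0)
    (hE : ∀ (n : ℕ) (a : Fin n → ℤ) (u : (Fin n → ℝ) → ℝ) (U : Set (Fin n → ℝ)),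
        IsOpen U → closure {x : Fin n → ℝ | ∀ j, 0 < x j ∧ x j < 1} ⊆ U → ContinuousOn u U →
        (∀ x ∈ U, u x ≠ 0) →
        MeasureTheory.IntegrableOn (fun x => u x * ∏ j, x j ^ (a j)) {x : Fin n → ℝ | ∀ j, 0 < x j ∧ x j < 1} →
        ∀ j, 0 ≤ a j)
    (hR : ∀ (n k : ℕ) (r : Literature.NumberTheory.Transcendental.KZ.IntegralRep n) (τ : Fin k → Set (Fin n → ℝ))
        (φ : Fin k → (Fin n → ℝ) → (Fin n → ℝ)) (φ' : Fin k → (Fin n → ℝ) → (Fin n → ℝ) →L[ℝ] (Fin n → ℝ))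
        (g : Fin k → (Fin n → ℝ) → ℝ) (U : Fin k → Set (Fin n → ℝ)),
        (∀ i, Literature.ModelTheory.ExponentialFields.IsSemialgebraic ℚ (τ i) ∧ Bornology.IsBounded (τ i) ∧
          Literature.NumberTheory.Transcendental.IsSemialgebraicMapOn ℚ (τ i) (φ i) ∧
          (∀ x ∈ τ i, HasFDerivWithinAt (φ i) (φ' i x) (τ i) x) ∧ Set.InjOn (φ i) (τ i) ∧
          Literature.ModelTheory.ExponentialFields.IsSemialgebraic ℚ (φ i '' τ i) ∧ φ i '' τ i ⊆ r.domain ∧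
          IsOpen (U i) ∧ closure (τ i) ⊆ U i ∧ ContDiffOn ℝ 1 (g i) (U i) ∧
          Literature.NumberTheory.Transcendental.IsSemialgebraicFunOn ℚ (τ i) (g i) ∧
          ∀ x ∈ τ i, g i x = r.integrand (φ i x) * |(φ' i x).det|) →
        (∀ i j, i ≠ j → MeasureTheory.volume (φ i '' τ i ∩ φ j '' τ j) = 0) →
        MeasureTheory.volume (r.domain \ ⋃ i, φ i '' τ i) = 0 →
        ∃ (k' : ℕ) (ρ : Fin k' → Literature.NumberTheory.Transcendental.KZ.IntegralRep n) (ε : Fin k' → ℤ),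
          (∀ i, Bornology.IsBounded (ρ i).domain ∧ ∃ V : Set (Fin n → ℝ), IsOpen V ∧ closure (ρ i).domain ⊆ V ∧
            ContDiffOn ℝ 1 (ρ i).integrand V) ∧
          Literature.NumberTheory.Transcendental.KZ.of r - ∑ i, ε i • Literature.NumberTheory.Transcendental.KZ.of (ρ i) ∈
            Literature.NumberTheory.Transcendental.KZ.relations) :
    Summit.KontsevichZagierPeriods.KontsevichZagierPeriods.Theses.VeryGoodTransfer.RationalRepsResolve := by
  intro n r₀ hr₀
  obtain ⟨R, hRb, hrel⟩ := exists_sub_sum_bounded_mem_relations r₀ hr₀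
  refine exists_fin_of_sub_sum
    (fun ρ : IntegralRep n => Bornology.IsBounded ρ.domain ∧ ∃ V : Set (Fin n → ℝ), IsOpen V ∧
      closure ρ.domain ⊆ V ∧ ContDiffOn ℝ 1 ρ.integrand V)
    (of r₀) R hrel fun T => ?_
  -- one bounded piece `r := R T` of rational shape `p / q`
  obtain ⟨hr, hb⟩ := hRb T
  generalize R T = r at hr hb ⊢
  classical
  obtain ⟨p, q, hq, hpq⟩ := hr
  by_cases hp : p = 0
  · refine ⟨0, Fin.elim0, Fin.elim0, fun i => i.elim0, ?_⟩
    rw [Finset.univ_eq_empty, Finset.sum_empty, sub_zero]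
    exact of_mem_relations_of_eqOn_zero r fun x hx => by simp [hpq hx, hp]
  obtain ⟨k, τ, φ, φ', u, U, a, hch, hdisj, hcov⟩ :=
    hA n r.domain p q r.isSemialgebraic_domain hb hp hq
  set C : Set (Fin n → ℝ) := {x | ∀ j, 0 < x j ∧ x j < 1} with hC
  have hCo : IsOpen C := isOpen_cube
  have hCm : MeasurableSet C := hCo.measurableSet
  have hCb : Bornology.IsBounded C := isBounded_cube
  -- (1) the exponents are non-negative
  have ha : ∀ i j, 0 ≤ a i j := by
    intro i
    obtain ⟨-, -, -, hφ', hinj, himg, -, hUo, hCU, hu, hu0, -, hmono⟩ := hch i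
    have h1 : IntegrableOn r.integrand (φ i '' C) := r.integrableOn.mono_set himg
    have h2 := (integrableOn_image_iff_integrableOn_abs_det_fderiv_smul volume hCm hφ' hinj
      r.integrand).1 h1
    have h3 : IntegrableOn (fun x => u i x * ∏ j, x j ^ (a i j)) C := by
      refine h2.congr_fun (fun x hx => ?_) hCm
      have hxσ : φ i x ∈ r.domain := himg ⟨x, hx, rfl⟩
      show |(φ' i x).det| • r.integrand (φ i x) = _
      rw [smul_eq_mul, hpq hxσ, mul_comm]
      exact hmono x hx
    exact hE n (a i) (u i) (U i) hUo hCU hu.continuousOn hu0 h3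
  -- (2) the `C¹` integrands
  set g : Fin k → (Fin n → ℝ) → ℝ := fun i x => u i x * ∏ j, x j ^ (a i j).toNat with hg
  have hg_eq : ∀ i x, g i x = u i x * ∏ j, x j ^ (a i j) := by
    intro i x
    simp only [hg]
    congr 1
    exact Finset.prod_congr rfl fun j _ => by
      rw [← zpow_natCast, Int.toNat_of_nonneg (ha i j)]
  have hgC1 : ∀ i, ContDiffOn ℝ 1 (g i) (U i) := by
    intro i
    obtain ⟨-, -, -, -, -, -, -, -, -, hu, -, -, -⟩ := hch i
    have hpoly : ContDiff ℝ 1 (fun x : Fin n → ℝ => ∏ j, x j ^ (a i j).toNat) :=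
      contDiff_prod fun j _ => (contDiff_apply ℝ ℝ j).pow _
    exact hu.mul hpoly.contDiffOn
  have hgsa : ∀ i, IsSemialgebraicFunOn ℚ (τ i) (g i) := by
    intro i
    obtain ⟨hτC, hτs, -, -, -, -, -, -, -, -, -, husa, -⟩ := hch i
    have h1 : IsSemialgebraicFunOn ℚ (τ i) (u i) := husa.mono hτC hτs
    have h2 : IsSemialgebraicFunOn ℚ (τ i) (fun x : Fin n → ℝ => ∏ j, x j ^ (a i j).toNat) :=
      (isSemialgebraicFunOn_aeval hτs
        (∏ j, (MvPolynomial.X j : MvPolynomial (Fin n) ℚ) ^ (a i j).toNat)).congr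
        fun x _ => by simp [map_prod]
    exact (IsSemialgebraicFunOn.mul_holds h1 h2).congr fun x _ => by simp [hg]
  -- (3) realise the atlas by the moves
  refine hR n k r τ φ φ' g U (fun i => ?_) hdisj hcov
  obtain ⟨hτC, hτs, hφs, hφ', hinj, himg, himgs, hUo, hCU, hu, hu0, husa, hmono⟩ := hch i
  refine ⟨hτs, hCb.subset hτC, hφs.mono hτC hτs, fun x hx => (hφ' x (hτC hx)).mono hτC,
    hinj.mono hτC, himgs, (image_mono hτC).trans himg, hUo, (closure_mono hτC).trans hCU,
    hgC1 i, hgsa i, fun x hx => ?_⟩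
  have hxσ : φ i x ∈ r.domain := himg ⟨x, hτC hx, rfl⟩
  rw [hg_eq, ← hmono x (hτC hx), hpq hxσ]

end Summit.KontsevichZagierPeriods.VeryGoodTransfer.RationalRepsResolveSplit
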